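import Mathlib
import HarnessLib
import Summits.HubbardSuperconductivity.HubbardSuperconductivity.Theorems.KLProgrammeKLRegimeTwoVolumeSrcTowerProducerFHA
import Summits.HubbardSuperconductivity.HubbardSuperconductivity.Theorems.KLProgrammeKLRegimeTwoVolumeSrcUVLevelOne
import Summits.HubbardSuperconductivity.HubbardSuperconductivity.Theorems.KLProgrammeKLRegimeTwoVolumeSrcTowerRows
import Summits.HubbardSuperconductivity.HubbardSuperconductivity.Theorems.KLProgrammeKLRegimeTwoVolumeSrcStepCovZeroAlphaW
import Summits.HubbardSuperconductivity.HubbardSuperconductivity.Theorems.KLProgrammeKLRegimeEngineScaleOneSrcProfileW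

/-!
# [VL lead k3c4-p1 g20: twin of p3 g21's `…TwoVolumeSrcUVLevelOne` (p686409) on `…SrcTowerBlockFA.sourceProfilesAtLevF_blockStep'` — E1's level-0 alive read-out is asked
# law-shaped only in degrees `≥ 4`, its degree 2 is `≤ C₀·Q₁.CE·ε_{n_β+1}/4` (cure (c1) of «(VL)-HE1-LEVEL0-DEG2»); extra `c`-door `c ≤ ε₀·log 4/(2Klam)` so that
# `ε_{n_β+1} ≤ ε₀`; rows from `twoScale_rows_of_small` at `2C₀` dominated back by `twoScale_rows_aal_of_twoC₀`.]
# Route `KLProgramme` — K3 VL child (stmt-HubbardSuperconductivity-23356), atom HUV-W (`stub_vl_srcUVW`), LEVEL 1: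
# `SourceProfilesAtLevF L M (klSrcBudget P Qo U (fun _ _ => A₁) 2) β U μ K (srcWindowFamily L M) 1 1 2` BY ONE SOURCE BLOCK STEP `(J₁,J₂,J′) = (1,2,1)`
# FROM THE LEVEL-0 DATUM, for every admissible frame (cell gate-hubbard-kl, seat p3 g21; pen (R307) route (B) = (α))

The level-`1` datum of the windowed token #24 (`𝒱_2[K]` analysed by `[E(F_1); E_W]`) is the block step `k = 0 → k + ℓ = 1` of the VL lead's
`…SrcTowerBlockF.sourceProfilesAtLevF_blockStep` (no `k ≥ 1` hypothesis), fed with: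
* the first step covariance `klStepCov … K 0 = S(F̃_0)ᵀC^K_{(Λ₂,Λ₁]}S(F̃_0)` — Gram `isGramBoundedR_klStepCov_zero_uniform`, weighted rows / columns
  `exists_alphaWt_klStepCov_zero` (both for EVERY `FrameOK` frame, no window: `…SrcStepCovZeroGridRows/AlphaW`);
* the level-`0` token `exists_sourceProfilesAtLevF_srcWindow_zero` (p3 g21, `…ScaleOneSrcProfileW`);
* as HYPOTHESES at the point of use (the producer has them): `Z^K_{Λ₁} ≠ 0` and the alive level-`0` read-out `S₀` with its law (`stub_vl_HE1free`'s
  clause at `j = 0`), and the weighted overlap rows / columns `cr = 81·CJ·M/β`, `cc = 81·2·CJ′·M/β` of `E(F_1)·S(F̃_0)` (E1's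
  `overlapWt_jump_sums_klEng_flow_all` / `overlapWt_colSum_klEng_flow_all` at `k = 0`, `J′ = 1`, history-bound);
* the five smallness rows by the lead's `twoScale_rows_of_small` (one `ε₀`, doors `U ≤ ε₀/(2Klam)`), the output package and amplitude in closed form.

* **`exists_sourceProfilesAtLevF_srcWindow_one`** — `∀ P R, WF → ∀ Q₁ (0 ≤ CE) C₀ ≥ 0, CJ CJ′ →  ∃ Qo (0 ≤ Qo.CE), ∃ c₁ > 0, ∀ c ≤ c₁, ∃ U₁ > 0, ∀ μ U β (regime),
  ∃ A₁ ≥ 0, ∀ L M ≥ (klEngL₃, klEngM₃), ∀ K, FrameOK R U (nScales β) μ K → Z^K_{Λ₁} ≠ 0 → ∀ S₀ (nonneg, law at Q₁ C₀, read-out of 𝒱_1@F_0) →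
  rows/cols of E(F_1)S(F̃_0) ≤ (81CJ M/β, 162CJ′ M/β) → SourceProfilesAtLevF L M (klSrcBudget P Qo U (fun _ _ => A₁) 2) β U μ K (srcWindowFamily L M) 1 1 2`.

HONEST SCOPE: the law of the alive degree-`2` read-out at level `0` is TAKEN from `stub_vl_HE1free` (located «HE1-LEVEL0-DEG2», KL STATUS l.9538 — not
re-derived here).  Everything is proved; no definitions, no sorry.  Nothing asserts HUV, HE1free, any stub, VL, K3 or superconductivity.
[cite: BenfattoGiulianiMastropietro2006, §2.7 (2.70)–(2.71a), §2.8 (2.80)–(2.83), §2.9 (4.3)–(4.8), §3 (3.2)–(3.8); cite: GawedzkiKupiainen1985GrossNeveu, §3]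
-/

noncomputable section

namespace Summit.HubbardSuperconductivity.HubbardSuperconductivity.Theorems.TwoVolumeDefect

set_option linter.dupNamespace false -- summit = problem name (single-conjunct summit), D-0017

open Real Finset Literature.MathematicalPhysics.QuantumLattice GrassmannAlgebra Literature.Probability.LatticeModels
open Literature.Probability.LatticeModels.BattleFederbush
open Summit.HubbardSuperconductivity.HubbardSuperconductivity.Theorems.KLProgrammeLegKernels
open Summit.HubbardSuperconductivity.HubbardSuperconductivity.Theorems.KLRegimeSplit
open Summit.HubbardSuperconductivity.HubbardSuperconductivity.Theorems.EngineV8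
open Summit.HubbardSuperconductivity.HubbardSuperconductivity.Theorems.TwoVolumeSource
open Summit.HubbardSuperconductivity.HubbardSuperconductivity.Theorems.ScaleZeroDecay
open Summit.HubbardSuperconductivity.HubbardSuperconductivity.Theorems.DispersionFlow

set_option maxHeartbeats 1600000 in -- one call of the 40-binder block step with closed-form constants
/-- **HUV-W LEVEL 1 — the windowed source profiles of `𝒱_2[K]` at `[E(F_1); E_W]`, law-shaped, for every admissible frame**, by ONE source block step
`(1, 2, 1)` from the level-`0` datum (see the module docstring for the inputs taken as hypotheses).
[cite: BenfattoGiulianiMastropietro2006, §2.7 (2.70)-(2.71a), §2.8 (2.80)-(2.83), §2.9 (4.3)-(4.8), §3 (3.2)-(3.8)] -/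
theorem exists_sourceProfilesAtLevF_srcWindow_one' (P : SplitConsts) (R : RenConsts) (hP : P.WF) (hR : R.WF2)
    (Q₁ : EngConsts) (hQ₁ : 0 ≤ Q₁.CE) (C₀ : ℝ) (hC₀ : 0 ≤ C₀) (CJ CJ' : ℝ) :
    ∃ Qo : EngConsts, 0 ≤ Qo.CE ∧ ∃ c₁ : ℝ, 0 < c₁ ∧ ∀ c : ℝ, 0 < c → c ≤ c₁ → ∃ U₁ : ℝ, 0 < U₁ ∧
      ∀ μ ∈ klWindowC, ∀ U : ℝ, 0 < U → U ≤ U₁ → ∀ β : ℝ, klBetaMin ≤ β → β ≤ Real.exp (c / U ^ 2) →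
        ∃ A₁ : ℝ, 0 ≤ A₁ ∧ ∀ (L M : ℕ) [NeZero L] [NeZero M], klEngL₃ β U ≤ L → klEngM₃ β U L ≤ M →
          ∀ K : TrigPolyC4v, FrameOK R U (nScales β) μ K →
          hubbardEffPartitionFnCT L M β U μ 0 K (klScale klE0 1) ≠ 0 →
          ∀ S₀ : ℕ → ℝ, (∀ m, 0 ≤ S₀ m) → (∀ d, 2 ≤ d → S₀ (2 * d) ≤ C₀ * klWtBudget P Q₁ U 1 (2 * d)) →
          S₀ 2 ≤ C₀ * Q₁.CE * epsCoupling P U (nScales β + 1) * ((4 : ℝ) ^ (0 + 1))⁻¹ →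
            (∀ (m : ℕ) (q : Fin m) (w : SpaceTimeIdx L M × SectorLeg (sectorCount 0)),
              klWtPinnedSumAt L M β μ K 0 0 m (klEffectiveAction L M β U μ K klE0 1) q w ≤ S₀ m) →
          (∀ X'', ∑ X', ‖(sectorAnalysisMatrix L M β (klAnisoFamily L M β μ K klE0 1) *
              sectorSubMatrix L M β (bgmFatMultiplier L M klE0 β (nambuXiCT L μ K) 0)) X'' X'‖ *
              klScaleWt L M β 1 {latticeLegPos (2 * (2 * M)) X'', latticeLegPos (2 * (2 * M)) X'} ≤ 81 * CJ * M / β) →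
          (∀ X', ∑ X'', ‖(sectorAnalysisMatrix L M β (klAnisoFamily L M β μ K klE0 1) *
              sectorSubMatrix L M β (bgmFatMultiplier L M klE0 β (nambuXiCT L μ K) 0)) X'' X'‖ *
              klScaleWt L M β 1 {latticeLegPos (2 * (2 * M)) X'', latticeLegPos (2 * (2 * M)) X'} ≤ 81 * (2 : ℝ) ^ 1 * CJ' * M / β) →
          SourceProfilesAtLevF L M (klSrcBudget P Qo U (fun _ _ => A₁) 2) β U μ K (srcWindowFamily L M) 1 1 2 := by
  have hKl : 0 < P.Klam := lt_of_lt_of_le one_pos hP.1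
  have hKl0 : 0 ≤ P.Klam := hKl.le
  have he : (0 : ℝ) < klE0 := by norm_num [klE0]
  have hRwf : R.WF := hR.wf
  have hGfr : ∀ i, 0 ≤ R.Gfr i := hRwf.2.2
  -- the level-0 token and the α-constant
  obtain ⟨CE₀, hCE₀, c₀, hc₀, hlev0⟩ := exists_sourceProfilesAtLevF_srcWindow_zero P R hP hR
  obtain ⟨D, hD, hαD⟩ := exists_alphaWt_klStepCov_zero
  set g : ℝ := (1 + R.Gfr 0 + R.Gfr 1 + R.Gfr 2 + R.Gfr 3) ^ 4 with hg
  have hg1 : 1 ≤ g := by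
    have : (1 : ℝ) ≤ 1 + R.Gfr 0 + R.Gfr 1 + R.Gfr 2 + R.Gfr 3 := by linarith [hGfr 0, hGfr 1, hGfr 2, hGfr 3]
    exact one_le_pow₀ this
  -- the Gram constant at `k = 0` and the dictionary constants `Cκ`, `Cb`
  set κ : ℝ := Real.sqrt (8 * (klScale klE0 1 / Real.pi + 3 / 128) * (1793 * klScale klE0 1 + 704) / klScale klE0 1) with hκdef
  have hΛ1 : 0 < klScale klE0 1 := klth_klScale_pos 1
  have hΛ2 : 0 < klScale klE0 2 := klth_klScale_pos 2
  have hκ : 0 < κ := Real.sqrt_pos.2 (by positivity)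
  set Cκ : ℝ := κ ^ 2 * 8 / (2 * klE0) with hCκ
  have hCκ0 : 0 < Cκ := by positivity
  have hσ8 : κ ^ 2 * (8 : ℝ) ^ (0 + 1) = 2 * Cκ * klE0 := by rw [hCκ]; field_simp; ring
  set Cb : ℝ := D * g * klScale klE0 2 with hCb
  have hCb0 : 0 < Cb := by positivity
  -- the closed-form constants at `θ = 1`, `ℓ = 1`
  set σc : ℝ := 2 * Cκ * klE0 with hσc
  set τc : ℝ := Real.exp 1 ^ 4 * (1 + 1) ^ 2 * (2 * Cκ * klE0) with hτc
  set Γ : ℝ := max 4 (2 * (Real.exp 1 ^ 4 * (1 + 1) ^ 2 * (2 * Cκ * klE0)) * (1 / (1 ^ 2 * (2 * Cκ * klE0)))) with hΓ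
  have hσ0 : 0 < σc := by positivity
  have hτ0 : 0 < τc := by positivity
  have hΓ0 : 0 ≤ Γ := le_trans (by norm_num) (le_max_left _ _)
  set Φb : ℝ := 256 * Real.exp 1 * Cb * (4 : ℝ) ^ 1 / Cκ with hΦb
  have hΦb0 : 0 ≤ Φb := by positivity
  set ccd : ℝ := max (81 * (2 : ℝ) ^ 1 * CJ' / 2) 1 with hccd
  have hccd1 : 1 ≤ ccd := le_max_right _ _
  -- the per-pair constant and the packages
  set Rr : ℝ := max (max Q₁.CE CE₀) (max 1 (16 * Φb * τc * (2 * C₀ * Q₁.CE ^ 2))) with hRr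
  have hR1 : 1 ≤ Rr := (le_max_left _ _).trans (le_max_right _ _)
  have hR0 : 0 < Rr := lt_of_lt_of_le one_pos hR1
  have hQ₁R : Q₁.CE ≤ Rr := (le_max_left _ _).trans (le_max_left _ _)
  have hCE₀R : CE₀ ≤ Rr := (le_max_right _ _).trans (le_max_left _ _)
  have hRbig : 16 * Φb * τc * (2 * C₀ * Q₁.CE ^ 2) ≤ Rr := (le_max_right _ _).trans (le_max_right _ _)
  set QR : EngConsts := { Q₁ with CE := Rr } with hQR
  set Qo : EngConsts := { Q₁ with CE := ccd ^ 2 * Γ * Rr } with hQo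
  have hQRCE : QR.CE = Rr := rfl
  have hQoCE : Qo.CE = ccd ^ 2 * Γ * Rr := rfl
  have hQo0 : 0 ≤ Qo.CE := by rw [hQoCE]; positivity
  -- one smallness
  set mM : ℝ := 64 * (Φb + 1) * (Real.exp 1 * τc + 1) ^ 2 * (σc + 1) * (Rr + 1) ^ 2 * (2 * C₀ * Q₁.CE + 2 * C₀ * Q₁.CE ^ 2 + 1) with hmM
  have hmM0 : 0 < mM := by positivity
  set ε₀ : ℝ := min 1 (1 / mM) with hε₀
  have hε₀0 : 0 < ε₀ := lt_min one_pos (by positivity)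
  have hε₀1 : ε₀ ≤ 1 := min_le_left _ _
  have hε₀m : ε₀ * mM ≤ 1 := by
    calc ε₀ * mM ≤ (1 / mM) * mM := mul_le_mul_of_nonneg_right (min_le_right _ _) hmM0.le
      _ = 1 := by field_simp
  -- the answer's package and doors
  have hlog4 : 0 < Real.log 4 := Real.log_pos (by norm_num)
  refine ⟨Qo, hQo0, min (min c₀ (klEngC₃6 P R)) (ε₀ * Real.log 4 / (2 * P.Klam)),
    lt_min (lt_min hc₀ (klEngC₃6_pos P R)) (by positivity), fun c hc hcc₁ => ?_⟩
  have hcc₀ : c ≤ c₀ := hcc₁.trans ((min_le_left _ _).trans (min_le_left _ _))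
  have hc6 : c ≤ klEngC₃6 P R := hcc₁.trans ((min_le_left _ _).trans (min_le_right _ _))
  have hcε : c ≤ ε₀ * Real.log 4 / (2 * P.Klam) := hcc₁.trans (min_le_right _ _)
  have hcD : c ≤ klE4C₃ R := hc6.trans (klEngC₃6_le_klE4C₃ P R)
  obtain ⟨U₀, hU₀, hlev0'⟩ := hlev0 c hc hcc₀
  refine ⟨min U₀ (min (klEngU₀6 P R c) (ε₀ / (2 * P.Klam))), lt_min hU₀ (lt_min (klEngU₀6_pos P R c) (by positivity)),
    fun μ hμ U hU hUU β hβmin hβc => ?_⟩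
  have hUU₀ : U ≤ U₀ := hUU.trans (min_le_left _ _)
  have hU6 : U ≤ klEngU₀6 P R c := hUU.trans ((min_le_right _ _).trans (min_le_left _ _))
  have hUε : U ≤ ε₀ / (2 * P.Klam) := hUU.trans ((min_le_right _ _).trans (min_le_right _ _))
  have hU3 : U ≤ klEngU₀3 P R c := hU6.trans (klEngU₀6_le_klEngU₀3 P R c)
  have hU1 : |U| ≤ 1 := abs_le_one_of_le_klEngU₀3 hU hU3
  have hβ : 0 < β := pos_of_klBetaMin_le hβmin
  have hN : (((nScales β : ℕ) : ℝ) + 1) * U ^ 2 ≤ 1 / 2 :=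
    (nScales_succ_mul_sq_le (U := U) hc.le hβmin hβc).trans (div_log_four_le_half_of_door hcD)
  obtain ⟨A₀, hA₀1, hlev0''⟩ := hlev0' μ hμ U hU hUU₀ β hβmin hβc
  have hA₀ : 0 ≤ A₀ := zero_le_one.trans hA₀1
  -- the couplings
  have hlampos : 0 < epsCoupling P U (0 + 1) := by
    unfold epsCoupling; positivity
  have hlamMax : epsCoupling P U (0 + 1) ≤ ε₀ := by
    unfold epsCoupling
    rw [abs_of_pos hU]
    have hU1' : U ≤ 1 := by rw [abs_of_pos hU] at hU1; exact hU1
    have h2 : U ^ 2 * (((0 + 1 : ℕ) : ℝ)) ≤ U := by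
      have h3 : U * U ≤ U * 1 := mul_le_mul_of_nonneg_left hU1' hU.le
      have h4 : (((0 + 1 : ℕ) : ℝ)) = 1 := by norm_num
      rw [h4, mul_one, pow_two]; linarith only [h3]
    have hKne : P.Klam ≠ 0 := hKl.ne'
    calc P.Klam * (U + U ^ 2 * (((0 + 1 : ℕ) : ℝ))) ≤ P.Klam * (ε₀ / (2 * P.Klam) + ε₀ / (2 * P.Klam)) :=
          mul_le_mul_of_nonneg_left (add_le_add hUε (h2.trans hUε)) hKl0
      _ = ε₀ := by field_simp; ring
  have hlamMaxN : epsCoupling P U (nScales β + 1) ≤ ε₀ := by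
    unfold epsCoupling
    rw [abs_of_pos hU]
    have hreg : IsKLRegime U c (-((nScales β + 1 : ℕ) : ℤ)) := isKLRegime_of_le_nScales_succ hc.le hβmin hβc le_rfl
    have hr : U ^ 2 * ((nScales β + 1 : ℕ) : ℝ) ≤ c / Real.log 4 := by
      have h := hreg
      unfold IsKLRegime at h
      rw [Int.cast_neg, Int.cast_natCast, abs_neg, Nat.abs_cast] at h
      rw [le_div_iff₀ hlog4]; exact h
    have h1 : c / Real.log 4 ≤ ε₀ / (2 * P.Klam) := by
      rw [div_le_iff₀ hlog4]
      calc c ≤ ε₀ * Real.log 4 / (2 * P.Klam) := hcε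
        _ = ε₀ / (2 * P.Klam) * Real.log 4 := by ring
    have hKne : P.Klam ≠ 0 := hKl.ne'
    calc P.Klam * (U + U ^ 2 * ((nScales β + 1 : ℕ) : ℝ)) ≤ P.Klam * (ε₀ / (2 * P.Klam) + ε₀ / (2 * P.Klam)) :=
          mul_le_mul_of_nonneg_left (add_le_add hUε (hr.trans h1)) hKl0
      _ = ε₀ := by field_simp; ring
  have haal0 : 0 ≤ C₀ * Q₁.CE * ε₀ := by positivity
  -- the output amplitude
  set Aout : ℝ := (16 : ℝ) ^ (0 + 1) * (max 1 A₀) ^ 2 / ε₀ ^ 2 *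
      (max (81 * CJ / 2) 1 * max (81 * (2 : ℝ) ^ 1 * CJ' / 2) 1 * (2 : ℝ) ^ (5 * 1) *
        (max 4 (2 * (Real.exp 1 ^ 4 * (1 + 1) ^ 2 * (2 * Cκ * klE0)) * (1 / (1 ^ 2 * (2 * Cκ * klE0)))) * QR.CE *
            ((C₀ + 2 * ε₀) * (1 + 8 * (2 * Cκ * klE0) * QR.CE) +
              Real.exp 1 * (C₀ * Q₁.CE / (2 * QR.CE) + 2 * ε₀ / 2 + ((2 * ε₀ + C₀ * Q₁.CE * ε₀) / (2 * QR.CE) + C₀ * (Q₁.CE / QR.CE) ^ 2 + 2 * ε₀))) +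
          ((C₀ + 2 * ε₀) * (1 + 8 * (2 * Cκ * klE0) * QR.CE) +
              Real.exp 1 * (C₀ * Q₁.CE / (2 * QR.CE) + 2 * ε₀ / 2 + ((2 * ε₀ + C₀ * Q₁.CE * ε₀) / (2 * QR.CE) + C₀ * (Q₁.CE / QR.CE) ^ 2 + 2 * ε₀))) +
          (2 * ε₀ + C₀ * Q₁.CE * ε₀))) with hAout
  have hAout0 : 0 ≤ Aout := by rw [hAout, hQRCE]; positivity
  refine ⟨Aout, hAout0, fun L M _ _ hL3 hM3 K hK hZ S₀ hS₀0 hS₀law hS₀two hS₀read hrow' hcol' => ?_⟩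
  have hS₀two' : S₀ 2 ≤ C₀ * Q₁.CE * ε₀ * ((4 : ℝ) ^ (0 + 1))⁻¹ :=
    hS₀two.trans (mul_le_mul_of_nonneg_right (mul_le_mul_of_nonneg_left hlamMaxN (mul_nonneg hC₀ hQ₁)) (by positivity))
  have hM0 : (0 : ℝ) < M := Nat.cast_pos.2 (Nat.pos_of_ne_zero (NeZero.ne M))
  -- the rows at `ℓ = 1`
  have h2C₀ : (0 : ℝ) ≤ 2 * C₀ := by positivity
  obtain ⟨hx₂, hx₁, hx₃, hw2, hV2⟩ := twoScale_rows_of_small hΦb0 le_rfl hτ0.le hσ0.le h2C₀ hQ₁ hR1 hRbig hε₀0.le (by rw [hmM] at hε₀m; exact hε₀m)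
      hε₀0.le le_rfl hε₀0.le le_rfl hε₀1
  obtain ⟨hw, hV⟩ := twoScale_rows_aal_of_twoC₀ hΦb0 hτ0.le hC₀ hR0 hε₀0.le hw2 hV2
  -- the block data at `k = 0`
  have hGB := isGramBoundedR_klStepCov_zero_uniform (V := L) (M := M) hK hβmin
  obtain ⟨hrow, hcol⟩ := hαD R U μ β (nScales β) K hRwf hU1 hN hK hβmin L M hL3 hM3 (0 + 1)
  have hα : (M : ℝ) / β * (D * (1 + R.Gfr 0 + R.Gfr 1 + R.Gfr 2 + R.Gfr 3) ^ 4) = Cb * ((M : ℝ) / β) / klScale klE0 (0 + 1 + 1) := by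
    rw [hCb, hg, show (0 + 1 + 1 : ℕ) = 2 from rfl]
    field_simp
  -- the level-0 token at `QR`
  have hin : SourceProfilesAtLevF L M (klSrcBudget P QR U (fun _ _ => A₀) (0 + 1)) β U μ K (srcWindowFamily L M) 0 0 (0 + 1) :=
    hlev0'' L M hL3 hM3 K hK QR (by rw [hQRCE]; exact hCE₀R)
  -- the call
  have h := sourceProfilesAtLevF_blockStep' (L := L) (M := M) hβ U μ K (srcWindowFamily L M) (k := 0) (ℓ := 1) le_rfl P hKl0 Q₁ QR Qo hQ₁
    (by rw [hQRCE]; exact hR0) (by rw [hQRCE]; exact hQ₁R) hQo0 hC₀ hε₀0 hε₀1 hlampos hlamMax hε₀1 hZ hCκ0 hCb0 one_pos hκ hσ8 hα rfl rfl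
    hGB hrow hcol hrow' hcol' S₀ hS₀0 hS₀law haal0 hS₀two' hS₀read hA₀ hin
    (by rw [hQRCE]; exact hx₂) (by rw [hQRCE]; exact hx₁) (by rw [hQRCE]; exact hx₃)
    (by rw [hQRCE]; exact hw) (by rw [hQRCE]; exact hV)
    (by rw [hQoCE, hQRCE, ← hccd, ← hΓ, pow_one]
        have h0 : 0 ≤ ccd ^ 2 * Γ * Rr := by positivity
        linarith only [h0])
    (Aout := Aout) le_rfl
  exact h

end Summit.HubbardSuperconductivity.HubbardSuperconductivity.Theorems.TwoVolumeDefect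

end
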